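import Mathlib
import HarnessLib
import Summits.HubbardSuperconductivity.HubbardSuperconductivity.Theorems.KLProgrammeKLRegimeEngineTwoLegStepV17F2ClosersGrid
import Summits.HubbardSuperconductivity.HubbardSuperconductivity.Theorems.KLProgrammeKLRegimeSplitFieldStrengthTimeMoment

/-!
# K3 gen 8, ENGINE child `KLRegimeEngineV17F2` (stmt-HubbardSuperconductivity-20437), stub (e) `stub_twoLeg_step`: the closer shell with residual B in
# DUAL-LATTICE MOMENT currency — two pinned weighted sums of the UNSECTORISED position-space two-leg kernel of `𝒱⁽ⁿ⁾[K_n] − 𝒩_{K_n}` (every scale)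

Cell gate-hubbard-kl, seat hubbard-kl-r2d-p1 (g6); plan g17 (R47j) («(e)-HLEV»; B-supplier bricks booked to this lane).  Stub (e)'s residual B = the two SIZES
`|z_n(K_n) − 1| ≤ Z·U²` (shell) and `‖∇ I_L[Re Σ_n(K_n) − K_n∘p]‖ ≤ S·U²` (tube).  This lane's shells consume them in three currencies already — fits (p531478 ff.), sizes
(p533715/p534923 `stub_twoLeg_step_of_engineSizes_GQ`, currency-neutral), GRID moments of `kernel₂ (W_n[K_n] − 𝒩_{K_n,4M})` (p538113).  A multiscale sectorised tower's
natural two-leg OUTPUT is a fourth: the unsectorised (trivial-multiplier) position-space two-leg kernel of the Grassmann element `G' := 𝒱⁽ⁿ⁾[K_n] − 𝒩_{K_n}` on the dual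
lattice `SpaceTimeIdx L M`, i.e. `sectorisedKernel L M β (trivialMultiplier L M) G' 2 (![((0,σ),0),((0,σ),1)]) x`, with its circular TIME first moment `Mᵗ` and its
OFF-DIAGONAL first SPACE moment `Mˢ♯₁` (p3's slot forms `TwoLegFourier.abs_klFieldStrength_sub_one_le_of_time_moment` (any `n`) and
`TwoLegFourier.norm_iteratedFDeriv_evalM_symInterp_locRe_le_offDiag` (generic `G`)).  This file states that shell at every scale:

* §1 **`twoLeg_sep_fderiv_of_dual_offDiag_moment`** — any `K`, any `n`: `Mˢ♯₁`-bound of `G' = 𝒱⁽ⁿ⁾[K] − 𝒩_K` ⇒ `‖fderiv (evalM (symInterp L (klLocSelfEnergyRe … K n − K∘p))) q‖ ≤ 2·Mˢ♯₁`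
  at EVERY `q` (through `klLocSelfEnergyRe_sub_frame_eq_locRe`, ∀ n); **`abs_klFieldStrength_sub_one_le_of_dual_time_moment_sub_counter`** — `Mᵗ`-bound of the SAME `G'`
  ⇒ `|klFieldStrength … K n k⃗ − 1| ≤ 2·Mᵗ` (the counterterm is invisible to `z`: `klFieldStrength_eq_fieldStrength_sub_counter`, p536884);
* §2 **`stub_twoLeg_step_of_dualMoments_GQ`** (package `(G, Q)` and thresholds as binders) and **`…_thr7`** (`G = klEngGeo7`, `Q` a binder): stub (e)'s literal binders +
  `hMt`, `hMs` on `G' = 𝒱⁽ⁿ⁾[K_n] − 𝒩_{K_n}` + `2·Mᵗ ≤ Z·U²`, `2·Mˢ♯₁ ≤ S·U²`, `Z, S ≤ 2^{10|11}e¹⁸κ₀⁴·klE3Acum R` + C1/C2 ⇒ `TwoLegStepV17F2 … n`.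

Proofs only; no definitions; nothing about the model is asserted; nothing asserts superconductivity.  References: BGM 2006 §2.1 (2.4)–(2.5), §2.3 (2.17), §2.4 (2.36)
[cite: BenfattoGiulianiMastropietro2006].
-/

noncomputable section

namespace Summit.HubbardSuperconductivity.HubbardSuperconductivity.Theorems.TwoLegFourier

set_option linter.dupNamespace false -- summit = problem name (single-conjunct summit), D-0017

open Finset Complex
open Literature.MathematicalPhysics.QuantumLattice Literature.Probability.LatticeModels GrassmannAlgebra
open Summit.HubbardSuperconductivity.HubbardSuperconductivity.Theorems.KLRegimeSplit
open Summit.HubbardSuperconductivity.HubbardSuperconductivity.Theorems.KLProgrammeLegKernels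

variable {L M : ℕ} [NeZero L] [NeZero M]

/-! ## §1 The dual-lattice bridges at every scale -/

/-- **ROW B2′ FROM THE OFF-DIAGONAL FIRST SPACE MOMENT OF `𝒱⁽ⁿ⁾[K] − 𝒩_K`, every scale, every frame**: if for both spins and every pin `x₀`
`ε_x Σ_{x : x 0 = x₀, x⃗₁ ≠ x⃗₀} (1+|Δx̃₀|+|Δx̃₁|)·‖sectorisedKernel (trivialMultiplier) (𝒱⁽ⁿ⁾[K] − 𝒩_K) 2 ((0,σ,+),(0,σ,−)) x‖ ≤ Mˢ♯₁`, then at EVERY `q : Momentum`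
`‖fderiv ℝ (evalM (symInterp L (klLocSelfEnergyRe … K n − K∘p))) q‖ ≤ 2·Mˢ♯₁`. -/
theorem twoLeg_sep_fderiv_of_dual_offDiag_moment {β : ℝ} (hβ : 0 < β) (U μ : ℝ) (K : TrigPolyC4v) (n : ℕ) {Ms : ℝ}
    (hMs : ∀ (σ : Fin 2) (x₀ : SpaceTimeIdx L M), imagTimeWeight β M *
      ∑ x ∈ (univ : Finset (Fin 2 → SpaceTimeIdx L M)).filter (fun x => x 0 = x₀ ∧ (x 1).2 ≠ (x 0).2),
        (1 + ((((x 1).2 - (x 0).2) 0).valMinAbs.natAbs : ℝ) + ((((x 1).2 - (x 0).2) 1).valMinAbs.natAbs : ℝ)) ^ 1 *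
          ‖sectorisedKernel L M β (trivialMultiplier L M) (klEffectiveAction L M β U μ K klE0 n - counterQuadratic L M β K) 2
            (![((0, σ), 0), ((0, σ), 1)] : Fin 2 → SectorLeg 1) x‖ ≤ Ms) :
    ∀ q : Momentum, ‖fderiv ℝ
      (evalM (symInterp L (fun p => klLocSelfEnergyRe L M β U μ K n p - K.eval (latticeMomentum L p)))) q‖ ≤ 2 * Ms := by
  intro q
  have hfun : (fun p => klLocSelfEnergyRe L M β U μ K n p - K.eval (latticeMomentum L p)) =
      fun p => (∑ σ : Fin 2, ((selfEnergy L M β (klEffectiveAction L M β U μ K klE0 n - counterQuadratic L M β K) (omega0 M, p) σ).re +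
        (selfEnergy L M β (klEffectiveAction L M β U μ K klE0 n - counterQuadratic L M β K) ((omega0 M).rev, p) σ).re)) / 4 := by
    funext p
    exact klLocSelfEnergyRe_sub_frame_eq_locRe hβ.ne' U μ K n p
  have h := norm_iteratedFDeriv_evalM_symInterp_locRe_le_offDiag hβ
    (klEffectiveAction L M β U μ K klE0 n - counterQuadratic L M β K) le_rfl hMs q
  rw [norm_iteratedFDeriv_one] at h
  rwa [hfun]

/-- **ROW B1′ FROM THE CIRCULAR TIME FIRST MOMENT OF `𝒱⁽ⁿ⁾[K] − 𝒩_K`, every scale, every frame** (the SAME element as in the space-moment row; the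
counterterm is invisible to the field strength): if for both spins and every pin `x₀`
`ε_x Σ_{x : x 0 = x₀} ε_x·circDist_{2M}(j₀,j₁)·‖sectorisedKernel (trivialMultiplier) (𝒱⁽ⁿ⁾[K] − 𝒩_K) 2 ((0,σ,+),(0,σ,−)) x‖ ≤ Mᵗ`, then
`|klFieldStrength … K n k⃗ − 1| ≤ 2·Mᵗ` at every torus momentum. -/
theorem abs_klFieldStrength_sub_one_le_of_dual_time_moment_sub_counter {β : ℝ} (hβ : 0 < β) (U μ : ℝ) (K : TrigPolyC4v) (n : ℕ)
    (k : TorusSite 2 L) {Mt : ℝ}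
    (hMt : ∀ (σ : Fin 2) (x₀ : SpaceTimeIdx L M), imagTimeWeight β M *
      ∑ x ∈ (univ : Finset (Fin 2 → SpaceTimeIdx L M)).filter (fun x => x 0 = x₀),
        imagTimeWeight β M * (circDist (2 * M) (x 0).1.val (x 1).1.val : ℝ) *
          ‖sectorisedKernel L M β (trivialMultiplier L M) (klEffectiveAction L M β U μ K klE0 n - counterQuadratic L M β K) 2
            (![((0, σ), 0), ((0, σ), 1)] : Fin 2 → SectorLeg 1) x‖ ≤ Mt) :
    |klFieldStrength L M β U μ K n k - 1| ≤ 2 * Mt := by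
  rw [klFieldStrength_eq_fieldStrength_sub_counter hβ.ne' U μ K n]
  exact abs_fieldStrength_sub_one_le_of_time_moment hβ _ k hMt

end Summit.HubbardSuperconductivity.HubbardSuperconductivity.Theorems.TwoLegFourier

namespace Summit.HubbardSuperconductivity.HubbardSuperconductivity.Theorems.EngineV8

set_option linter.dupNamespace false -- summit = problem name (single-conjunct summit), D-0017

open Real Finset Literature.MathematicalPhysics.QuantumLattice Literature.Probability.LatticeModels GrassmannAlgebra
open Literature.MathematicalPhysics.QuantumLattice.FermiRG Literature.MathematicalPhysics.QuantumLattice.BandSectorCounting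
open Summit.HubbardSuperconductivity.HubbardSuperconductivity.Theorems.KLProgrammeLegKernels
open Summit.HubbardSuperconductivity.HubbardSuperconductivity.Theorems.DispersionFlow
open Summit.HubbardSuperconductivity.HubbardSuperconductivity.Theorems.PerturbedFermiCurve
open Summit.HubbardSuperconductivity.HubbardSuperconductivity.Theorems.KLRegimeSplit
open Summit.HubbardSuperconductivity.HubbardSuperconductivity.Theorems.TwoPointAssembly
open Summit.HubbardSuperconductivity.HubbardSuperconductivity.Theorems.TwoLegFourier

/-! ## §2 The stub-(e) shell in dual-lattice moment currency -/

/-- **STUB (e) OF 20437 WITH RESIDUAL B IN DUAL-LATTICE MOMENT CURRENCY, package `(G, Q)` and thresholds as binders.**  Package rows `hGS`, `hQS`, `hQCL`;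
doors `c₃ ≤ klEngC₃3 P R`, `U₀c ≤ klEngU₀4 P R c`, `U₀c ≤ klE3U₀all R`; the stub's literal binders at `(G, Q)`; then, with `K_n := klFlowFrameU L M β U μ n` and
`G' := klEffectiveAction … K_n klE0 n − counterQuadratic … K_n`: `hMt` (circular time first moment of the trivial-multiplier two-leg kernel of `G'`), `hMs` (its off-diagonal
first space moment), the conversions `2·Mᵗ ≤ Z·U²`, `2·Mˢ♯₁ ≤ S·U²`, the allowances `hZa`, `hSa`, and C1 `hcut`, C2 `hsp` ⇒ `TwoLegStepV17F2 L M G P Q R β U μ n`. -/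
theorem stub_twoLeg_step_of_dualMoments_GQ (G : GeoConsts) (Q : EngConsts) {c₃ U₀c : ℝ} (P : SplitConsts) (R : RenConsts) (c : ℝ)
    (hGS : ∀ k, klC4aJetC k ≤ G.S k) (hQS : ∀ k, klC4aJetC' P R k ≤ Q.S' k) (hQCL : ∀ (β : ℝ) (n : ℕ), 0 ≤ Q.CL β n)
    (hc₃ : c₃ ≤ klEngC₃3 P R) (hU₀ : U₀c ≤ klEngU₀4 P R c) (hU₀all : U₀c ≤ klE3U₀all R) (hP : P.WF) (hR : R.WF2) (hc : 0 < c) (hc3 : c ≤ c₃)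
    (μ : ℝ) (hμ : μ ∈ klWindowC) (U : ℝ) (hU : 0 < U) (hUle : U ≤ U₀c) (β : ℝ) (hβ : klBetaMin ≤ β) (hβc : β ≤ Real.exp (c / U ^ 2))
    (L M : ℕ) [NeZero L] [NeZero M] (hL : klEngL₃ β U ≤ L) (hM : klEngM₃ β U L ≤ M)
    (n : ℕ) (hn1 : 1 ≤ n) (hn : n ≤ nScales β + 1) (hreg : IsKLRegime U c (-(n : ℤ)))
    (hhist : HistP klPredsV17F2 L M G P Q R β U μ 0 n)
    (hfr : FrameOK R U (nScales β) μ (klFlowFrameU L M β U μ n))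
    (hE : EngineBoundsAtV17F2 L M G P Q β U μ n)
    (hJ : TwoLegReadJetBound L M klC4aJetC (klC4aJetC' P R) β U μ (klFlowFrameU L M β U μ n) n)
    {Mt Ms Z S : ℝ}
    (hMt : ∀ (σ : Fin 2) (x₀ : SpaceTimeIdx L M), imagTimeWeight β M *
      ∑ x ∈ (univ : Finset (Fin 2 → SpaceTimeIdx L M)).filter (fun x => x 0 = x₀),
        imagTimeWeight β M * (circDist (2 * M) (x 0).1.val (x 1).1.val : ℝ) *
          ‖sectorisedKernel L M β (trivialMultiplier L M)
            (klEffectiveAction L M β U μ (klFlowFrameU L M β U μ n) klE0 n - counterQuadratic L M β (klFlowFrameU L M β U μ n)) 2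
            (![((0, σ), 0), ((0, σ), 1)] : Fin 2 → SectorLeg 1) x‖ ≤ Mt)
    (hMs : ∀ (σ : Fin 2) (x₀ : SpaceTimeIdx L M), imagTimeWeight β M *
      ∑ x ∈ (univ : Finset (Fin 2 → SpaceTimeIdx L M)).filter (fun x => x 0 = x₀ ∧ (x 1).2 ≠ (x 0).2),
        (1 + ((((x 1).2 - (x 0).2) 0).valMinAbs.natAbs : ℝ) + ((((x 1).2 - (x 0).2) 1).valMinAbs.natAbs : ℝ)) ^ 1 *
          ‖sectorisedKernel L M β (trivialMultiplier L M)
            (klEffectiveAction L M β U μ (klFlowFrameU L M β U μ n) klE0 n - counterQuadratic L M β (klFlowFrameU L M β U μ n)) 2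
            (![((0, σ), 0), ((0, σ), 1)] : Fin 2 → SectorLeg 1) x‖ ≤ Ms)
    (hZ : 2 * Mt ≤ Z * U ^ 2) (hS : 2 * Ms ≤ S * U ^ 2)
    (hZa : Z ≤ (2 : ℝ) ^ 10 * Real.exp 1 ^ 18 * Real.sqrt (2 * (7 + 1606732)) ^ 4 * klE3Acum R)
    (hSa : S ≤ (2 : ℝ) ^ 11 * Real.exp 1 ^ 18 * Real.sqrt (2 * (7 + 1606732)) ^ 4 * klE3Acum R)
    (hcut : ∀ (Mq : ℕ → ℕ) (L₁ M₁ M₂ : ℕ) [NeZero L₁] [NeZero M₁] [NeZero M₂], L ≤ L₁ → Q.M0 β L₁ ≤ M₁ → Mq L₁ ≤ M₁ → M₁ ≤ M₂ →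
      (∀ j < n, histV17F2 L₁ M₁ G P Q R β U μ j ∧ TwoLegSlopes L₁ M₁ R β U μ (klFlowFrameU L₁ M₁ β U μ j) j) →
      (∀ j < n, histV17F2 L₁ M₂ G P Q R β U μ j ∧ TwoLegSlopes L₁ M₂ R β U μ (klFlowFrameU L₁ M₂ β U μ j) j) →
        ∀ θ : ℝ, |klLocalPart L₁ M₁ β U μ (klFlowFrameU L₁ M₁ β U μ n) n θ -
          klLocalPart L₁ M₂ β U μ (klFlowFrameU L₁ M₂ β U μ n) n θ| ≤ Q.CL β n / 4 / L₁)
    (hsp : ∀ (Mq : ℕ → ℕ) (L₁ L₂ M₂ : ℕ) [NeZero L₁] [NeZero L₂] [NeZero M₂], L ≤ L₁ → L₁ ∣ L₂ → Q.M0 β L₁ ≤ M₂ → Mq L₁ ≤ M₂ →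
      Q.M0 β L₂ ≤ M₂ → Mq L₂ ≤ M₂ →
      (∀ j < n, histV17F2 L₁ M₂ G P Q R β U μ j ∧ TwoLegSlopes L₁ M₂ R β U μ (klFlowFrameU L₁ M₂ β U μ j) j) →
      (∀ j < n, histV17F2 L₂ M₂ G P Q R β U μ j ∧ TwoLegSlopes L₂ M₂ R β U μ (klFlowFrameU L₂ M₂ β U μ j) j) →
        ∀ θ : ℝ, |klLocalPart L₁ M₂ β U μ (klFlowFrameU L₁ M₂ β U μ n) n θ -
          klLocalPart L₂ M₂ β U μ (klFlowFrameU L₂ M₂ β U μ n) n θ| ≤ Q.CL β n / 4 / L₁) :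
    TwoLegStepV17F2 L M G P Q R β U μ n := by
  have hβ0 : 0 < β := lt_of_lt_of_le (by norm_num [klBetaMin]) hβ
  have hzZ : ∀ k ∈ klShell L μ (klFlowFrameU L M β U μ n) n,
      |klFieldStrength L M β U μ (klFlowFrameU L M β U μ n) n k - 1| ≤ Z * U ^ 2 := fun k _ =>
    (abs_klFieldStrength_sub_one_le_of_dual_time_moment_sub_counter hβ0 U μ (klFlowFrameU L M β U μ n) n k hMt).trans hZ
  have hmS : ∀ q : Momentum, |frameLevel μ (klFlowFrameU L M β U μ n) q| ≤ klScale klE0 n →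
      ‖fderiv ℝ (evalM (symInterp L (fun p => klLocSelfEnergyRe L M β U μ (klFlowFrameU L M β U μ n) n p -
        (klFlowFrameU L M β U μ n).eval (latticeMomentum L p)))) q‖ ≤ S * U ^ 2 := fun q _ =>
    (twoLeg_sep_fderiv_of_dual_offDiag_moment hβ0 U μ (klFlowFrameU L M β U μ n) n hMs q).trans hS
  exact stub_twoLeg_step_of_engineSizes_GQ G Q P R c hGS hQS hQCL hc₃ hU₀ hU₀all hP hR hc hc3 μ hμ U hU hUle β hβ hβc L M hL hM n hn1 hn hreg
    hhist hfr hE hJ hZa hSa hzZ hmS hcut hsp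

/-- **The same at the registered GEOMETRY package `G = klEngGeo7`, `Q` a binder** (pass `klC4aJetC'_le_klEngQ7_S'`, `klEngQ7_CL_nonneg`, `klEngC₃6_le_klEngC₃3`,
`klEngU₀9_le_klEngU₀4`, `klEngU₀9_le_klE3U₀all` for the registered `(klEngQ7 P R, klEngC₃6, klEngU₀9)`). -/
theorem stub_twoLeg_step_of_dualMoments_thr7 (Q : EngConsts) {c₃ U₀c : ℝ} (P : SplitConsts) (R : RenConsts) (c : ℝ)
    (hQS : ∀ k, klC4aJetC' P R k ≤ Q.S' k) (hQCL : ∀ (β : ℝ) (n : ℕ), 0 ≤ Q.CL β n)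
    (hc₃ : c₃ ≤ klEngC₃3 P R) (hU₀ : U₀c ≤ klEngU₀4 P R c) (hU₀all : U₀c ≤ klE3U₀all R) (hP : P.WF) (hR : R.WF2) (hc : 0 < c) (hc3 : c ≤ c₃)
    (μ : ℝ) (hμ : μ ∈ klWindowC) (U : ℝ) (hU : 0 < U) (hUle : U ≤ U₀c) (β : ℝ) (hβ : klBetaMin ≤ β) (hβc : β ≤ Real.exp (c / U ^ 2))
    (L M : ℕ) [NeZero L] [NeZero M] (hL : klEngL₃ β U ≤ L) (hM : klEngM₃ β U L ≤ M)
    (n : ℕ) (hn1 : 1 ≤ n) (hn : n ≤ nScales β + 1) (hreg : IsKLRegime U c (-(n : ℤ)))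
    (hhist : HistP klPredsV17F2 L M klEngGeo7 P Q R β U μ 0 n)
    (hfr : FrameOK R U (nScales β) μ (klFlowFrameU L M β U μ n))
    (hE : EngineBoundsAtV17F2 L M klEngGeo7 P Q β U μ n)
    (hJ : TwoLegReadJetBound L M klC4aJetC (klC4aJetC' P R) β U μ (klFlowFrameU L M β U μ n) n)
    {Mt Ms Z S : ℝ}
    (hMt : ∀ (σ : Fin 2) (x₀ : SpaceTimeIdx L M), imagTimeWeight β M *
      ∑ x ∈ (univ : Finset (Fin 2 → SpaceTimeIdx L M)).filter (fun x => x 0 = x₀),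
        imagTimeWeight β M * (circDist (2 * M) (x 0).1.val (x 1).1.val : ℝ) *
          ‖sectorisedKernel L M β (trivialMultiplier L M)
            (klEffectiveAction L M β U μ (klFlowFrameU L M β U μ n) klE0 n - counterQuadratic L M β (klFlowFrameU L M β U μ n)) 2
            (![((0, σ), 0), ((0, σ), 1)] : Fin 2 → SectorLeg 1) x‖ ≤ Mt)
    (hMs : ∀ (σ : Fin 2) (x₀ : SpaceTimeIdx L M), imagTimeWeight β M *
      ∑ x ∈ (univ : Finset (Fin 2 → SpaceTimeIdx L M)).filter (fun x => x 0 = x₀ ∧ (x 1).2 ≠ (x 0).2),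
        (1 + ((((x 1).2 - (x 0).2) 0).valMinAbs.natAbs : ℝ) + ((((x 1).2 - (x 0).2) 1).valMinAbs.natAbs : ℝ)) ^ 1 *
          ‖sectorisedKernel L M β (trivialMultiplier L M)
            (klEffectiveAction L M β U μ (klFlowFrameU L M β U μ n) klE0 n - counterQuadratic L M β (klFlowFrameU L M β U μ n)) 2
            (![((0, σ), 0), ((0, σ), 1)] : Fin 2 → SectorLeg 1) x‖ ≤ Ms)
    (hZ : 2 * Mt ≤ Z * U ^ 2) (hS : 2 * Ms ≤ S * U ^ 2)
    (hZa : Z ≤ (2 : ℝ) ^ 10 * Real.exp 1 ^ 18 * Real.sqrt (2 * (7 + 1606732)) ^ 4 * klE3Acum R)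
    (hSa : S ≤ (2 : ℝ) ^ 11 * Real.exp 1 ^ 18 * Real.sqrt (2 * (7 + 1606732)) ^ 4 * klE3Acum R)
    (hcut : ∀ (Mq : ℕ → ℕ) (L₁ M₁ M₂ : ℕ) [NeZero L₁] [NeZero M₁] [NeZero M₂], L ≤ L₁ → Q.M0 β L₁ ≤ M₁ → Mq L₁ ≤ M₁ → M₁ ≤ M₂ →
      (∀ j < n, histV17F2 L₁ M₁ klEngGeo7 P Q R β U μ j ∧ TwoLegSlopes L₁ M₁ R β U μ (klFlowFrameU L₁ M₁ β U μ j) j) →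
      (∀ j < n, histV17F2 L₁ M₂ klEngGeo7 P Q R β U μ j ∧ TwoLegSlopes L₁ M₂ R β U μ (klFlowFrameU L₁ M₂ β U μ j) j) →
        ∀ θ : ℝ, |klLocalPart L₁ M₁ β U μ (klFlowFrameU L₁ M₁ β U μ n) n θ -
          klLocalPart L₁ M₂ β U μ (klFlowFrameU L₁ M₂ β U μ n) n θ| ≤ Q.CL β n / 4 / L₁)
    (hsp : ∀ (Mq : ℕ → ℕ) (L₁ L₂ M₂ : ℕ) [NeZero L₁] [NeZero L₂] [NeZero M₂], L ≤ L₁ → L₁ ∣ L₂ → Q.M0 β L₁ ≤ M₂ → Mq L₁ ≤ M₂ →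
      Q.M0 β L₂ ≤ M₂ → Mq L₂ ≤ M₂ →
      (∀ j < n, histV17F2 L₁ M₂ klEngGeo7 P Q R β U μ j ∧ TwoLegSlopes L₁ M₂ R β U μ (klFlowFrameU L₁ M₂ β U μ j) j) →
      (∀ j < n, histV17F2 L₂ M₂ klEngGeo7 P Q R β U μ j ∧ TwoLegSlopes L₂ M₂ R β U μ (klFlowFrameU L₂ M₂ β U μ j) j) →
        ∀ θ : ℝ, |klLocalPart L₁ M₂ β U μ (klFlowFrameU L₁ M₂ β U μ n) n θ -
          klLocalPart L₂ M₂ β U μ (klFlowFrameU L₂ M₂ β U μ n) n θ| ≤ Q.CL β n / 4 / L₁) :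
    TwoLegStepV17F2 L M klEngGeo7 P Q R β U μ n :=
  stub_twoLeg_step_of_dualMoments_GQ klEngGeo7 Q P R c klC4aJetC_le_klEngGeo7_S hQS hQCL hc₃ hU₀ hU₀all hP hR hc hc3 μ hμ U hU hUle β hβ hβc
    L M hL hM n hn1 hn hreg hhist hfr hE hJ hMt hMs hZ hS hZa hSa hcut hsp

end Summit.HubbardSuperconductivity.HubbardSuperconductivity.Theorems.EngineV8

end
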